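import Mathlib
import HarnessLib
import Summits.NavierStokesRegularity.NavierStokesRegularity.Theorems.QuarterLogPincerTypeIQuantSubcubicExpFlatWindowExplicitWindow

/-!
# LINE `analytic_window` of crux `TypeIQuantSubcubicExp` (stmt-NavierStokesRegularity-24077) — S1 PROVED:
  super-exponential flatness of short-period Gevrey-1 orbits (`gevreyFlatness_holds`)

Author of every statement and proof below: **ns-idea-7 g6** (line `analytic_window`, tree copy v4 sha12 `2d3691688f08`;
critics idea-crit-7 g3 BACKSTOP 15:07:08Z + idea-crit-4 g5 PASS 15:22:20Z). Texts VERBATIM (same namespace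
`…Cruxes.TypeIQuantSubcubicExp.AnalyticWindow`, same names), only re-homed into an importable module — crux workfiles
under `Cruxes/…/Lines/` are not importable from `Theorems/`. Landed by ns-tc-p1 g5 (LEAD lineage of 24077) on
DIRECTOR-NS #244 (b), `--supports stmt-NavierStokesRegularity-24077 --as helper`.

An `S`-periodic smooth curve `g : ℝ → ℝ³` with Gevrey-1 bounds `‖g⁽ⁿ⁾‖ ≤ C₁ n!/θⁿ` (`n ≥ 1`) and `0 < S ≤ θ` is
super-exponentially flat: `‖g'‖ ≤ 9 C₁ θ⁻¹ e^{−θ/(2S)}`.  Mechanism: the tree's periodic Poincaré lemma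
`FlatWindow.periodic_deriv_norm_le` (p633176) ITERATES (`‖g'‖ ≤ S‖g''‖ ≤ … ≤ Sⁿ⁻¹‖g⁽ⁿ⁾‖`), then the choice
`n = ⌊θ/S⌋` with Stirling's upper bound (`factorial_le_stirling_upper`, from `Stirling.stirlingSeq'_antitone`),
`cube_le_exp`, the numerical heart `key_ineq` (`e²x^{3/2}e^{−x} ≤ 9e^{−x/2}`, uses `27e ≤ 81`) and the optimisation
`flat_optimise`.  Pure real analysis; no Navier–Stokes object occurs in this file.

HONEST FRAMING: a RUNG line on the DSS wall, NEAR-ONE LANE ONLY (barrier `NearOneDssTypeIExclusion`, one-slice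
conjunct); it does NOT conclude the crux `TypeIQuantSubcubicExp` (24077), does not narrow S3 `stub_thinCascadeLiouville`
of `Lines/thin_cascade.lean`, and proves no summit statement; NS regularity is OPEN. The line's only `sorry`, S2a
`stub_slabJets` (class-uniform analyticity jets), is NOT in this file and is keyed to no prover.
-/

noncomputable section

-- the summit-side namespace repeats a component by design (D-0017)
set_option linter.dupNamespace false

namespace Summit.NavierStokesRegularity.NavierStokesRegularity.Cruxes.TypeIQuantSubcubicExp.AnalyticWindow

open MeasureTheory Set Function Filter Topology Metric
open scoped Nat
open Literature.Analysis Literature.Analysis.FluidPDE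
open Summit.NavierStokesRegularity.NavierStokesRegularity.Cruxes.TypeIQuantSubcubicExp.FlatWindow

section GevreyFlatness
open Real

/-! ### S1 proved: super-exponential flatness of short-period Gevrey-1 orbits (verbatim from `Lines/analytic_window.lean` v4) -/

/-- Stirling upper bound `(m+1)! ≤ e √(m+1) ((m+1)/e)^{m+1}` from `Stirling.stirlingSeq'_antitone`. -/
theorem factorial_le_stirling_upper (m : ℕ) :
    ((m + 1)! : ℝ) ≤ exp 1 * √((m : ℝ) + 1) * (((m : ℝ) + 1) / exp 1) ^ (m + 1) := by
  have hanti := Stirling.stirlingSeq'_antitone (Nat.zero_le m)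
  simp only [Function.comp, Nat.succ_eq_add_one, zero_add, Stirling.stirlingSeq_one] at hanti
  unfold Stirling.stirlingSeq at hanti
  push_cast at hanti
  have hN : (0 : ℝ) < (m : ℝ) + 1 := by positivity
  have hpos : 0 < √(2 * ((m : ℝ) + 1)) * (((m : ℝ) + 1) / exp 1) ^ (m + 1) := by positivity
  rw [div_le_iff₀ hpos] at hanti
  have hsqrt : √(2 * ((m : ℝ) + 1)) = √2 * √((m : ℝ) + 1) := Real.sqrt_mul (by norm_num) _
  have h2 : (0 : ℝ) < √2 := by positivity
  calc ((m + 1)! : ℝ) ≤ exp 1 / √2 * (√(2 * ((m : ℝ) + 1)) * (((m : ℝ) + 1) / exp 1) ^ (m + 1)) := hanti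
    _ = exp 1 * √((m : ℝ) + 1) * (((m : ℝ) + 1) / exp 1) ^ (m + 1) := by
        rw [hsqrt]; field_simp

/-- `x³ ≤ 27 e^{x−3}` for `x ≥ 0` (from `1 + t ≤ eᵗ` at `t = x/3 − 1`, cubed). -/
theorem cube_le_exp (x : ℝ) (hx : 0 ≤ x) : x ^ 3 ≤ 27 * exp (x - 3) := by
  have h1 : x / 3 ≤ exp (x / 3 - 1) := by
    have := Real.add_one_le_exp (x / 3 - 1)
    linarith
  have h3 : (x / 3) ^ 3 ≤ exp (x / 3 - 1) ^ 3 := pow_le_pow_left₀ (by positivity) h1 3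
  have h4 : exp (x / 3 - 1) ^ 3 = exp (x - 3) := by
    rw [← Real.exp_nat_mul]; congr 1; push_cast; ring
  rw [h4] at h3
  have h5 : (x / 3) ^ 3 = x ^ 3 / 27 := by ring
  rw [h5, div_le_iff₀ (by norm_num : (0 : ℝ) < 27)] at h3
  linarith

/-- The numerical heart: `e² x^{3/2} e^{−x} ≤ 9 e^{−x/2}` for `x ≥ 1` (uses `27e ≤ 81`). -/
theorem key_ineq (x : ℝ) (hx : 1 ≤ x) :
    exp 1 ^ 2 * x * √x * exp (-x) ≤ 9 * exp (-(x / 2)) := by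
  have hx0 : 0 ≤ x := by linarith
  have hA : 0 ≤ exp 1 ^ 2 * x * √x * exp (-x) := by positivity
  have hB : 0 ≤ 9 * exp (-(x / 2)) := by positivity
  rw [← pow_le_pow_iff_left₀ hA hB two_ne_zero]
  have hsq : √x ^ 2 = x := Real.sq_sqrt hx0
  have hL : (exp 1 ^ 2 * x * √x * exp (-x)) ^ 2 = exp 1 ^ 4 * x ^ 3 * (exp (-x) * exp (-x)) := by
    have : (exp 1 ^ 2 * x * √x * exp (-x)) ^ 2 = exp 1 ^ 4 * x ^ 2 * √x ^ 2 * (exp (-x) * exp (-x)) := by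
      ring
    rw [this, hsq]; ring
  have hR : (9 * exp (-(x / 2))) ^ 2 = 81 * exp (-x) := by
    rw [mul_pow, sq (exp _), ← Real.exp_add, show -(x / 2) + -(x / 2) = -x by ring]; norm_num
  rw [hL, hR]
  have hcube := cube_le_exp x hx0
  have he4 : exp 1 ^ 4 * exp (x - 3) * (exp (-x) * exp (-x)) = exp 1 * exp (-x) := by
    rw [← Real.exp_nat_mul, ← Real.exp_add, ← Real.exp_add, ← Real.exp_add, ← Real.exp_add]
    congr 1; push_cast; ring
  have he3 : exp 1 ≤ 3 := by have := Real.exp_one_lt_d9; linarith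
  have hpos : 0 ≤ exp 1 ^ 4 * (exp (-x) * exp (-x)) := by positivity
  calc exp 1 ^ 4 * x ^ 3 * (exp (-x) * exp (-x))
      = x ^ 3 * (exp 1 ^ 4 * (exp (-x) * exp (-x))) := by ring
    _ ≤ (27 * exp (x - 3)) * (exp 1 ^ 4 * (exp (-x) * exp (-x))) :=
        mul_le_mul_of_nonneg_right hcube hpos
    _ = 27 * (exp 1 ^ 4 * exp (x - 3) * (exp (-x) * exp (-x))) := by ring
    _ = 27 * (exp 1 * exp (-x)) := by rw [he4]
    _ ≤ 27 * (3 * exp (-x)) := by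
        have := mul_le_mul_of_nonneg_right he3 (Real.exp_pos (-x)).le
        linarith
    _ = 81 * exp (-x) := by ring

/-- The optimisation step: if `D ≤ C₁ (m+1)! S^m/θ^{m+1}` for every `m`, `0 ≤ C₁` and `0 < S ≤ θ`, then
`D ≤ 9 C₁ θ⁻¹ e^{−θ/(2S)}` (take `m + 1 = ⌊θ/S⌋`, Stirling, `key_ineq`). -/
theorem flat_optimise {C₁ θ S D : ℝ} (hC : 0 ≤ C₁) (hS : 0 < S) (hSθ : S ≤ θ)
    (hD : ∀ m : ℕ, D ≤ C₁ * ((m + 1)! : ℝ) * S ^ m / θ ^ (m + 1)) :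
    D ≤ 9 * C₁ / θ * exp (-(θ / (2 * S))) := by
  have hθ : 0 < θ := lt_of_lt_of_le hS hSθ
  -- x = θ/S ≥ 1 and its integer part n = m + 1
  have hx1 : 1 ≤ θ / S := by rw [le_div_iff₀ hS]; linarith
  have hx0 : 0 ≤ θ / S := by linarith
  have hfl : ⌊θ / S⌋₊ ≠ 0 := (Nat.floor_pos.mpr hx1).ne'
  obtain ⟨m, hm⟩ := Nat.exists_eq_succ_of_ne_zero hfl
  have hNx : (m : ℝ) + 1 ≤ θ / S := by
    have := Nat.floor_le hx0
    rw [hm] at this; push_cast at this; linarith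
  have hxN : θ / S < (m : ℝ) + 1 + 1 := by
    have := Nat.lt_floor_add_one (θ / S)
    rw [hm] at this; push_cast at this; linarith
  have hN : (0 : ℝ) < (m : ℝ) + 1 := by positivity
  -- Stirling
  have hst := factorial_le_stirling_upper m
  have hDm := hD m
  have hstep1 : C₁ * ((m + 1)! : ℝ) * S ^ m / θ ^ (m + 1) ≤
      C₁ * (exp 1 * √((m : ℝ) + 1) * (((m : ℝ) + 1) / exp 1) ^ (m + 1)) * S ^ m / θ ^ (m + 1) := by
    have h0 : 0 ≤ S ^ m / θ ^ (m + 1) := by positivity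
    have := mul_le_mul_of_nonneg_left hst hC
    calc C₁ * ((m + 1)! : ℝ) * S ^ m / θ ^ (m + 1) = C₁ * ((m + 1)! : ℝ) * (S ^ m / θ ^ (m + 1)) := by ring
      _ ≤ C₁ * (exp 1 * √((m : ℝ) + 1) * (((m : ℝ) + 1) / exp 1) ^ (m + 1)) * (S ^ m / θ ^ (m + 1)) :=
          mul_le_mul_of_nonneg_right this h0
      _ = _ := by ring
  -- rewrite the Stirling expression as (e √N / S) · (N S/(e θ))^{m+1}
  have hrew : C₁ * (exp 1 * √((m : ℝ) + 1) * (((m : ℝ) + 1) / exp 1) ^ (m + 1)) * S ^ m / θ ^ (m + 1)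
      = C₁ * (exp 1 * √((m : ℝ) + 1) / S) * (((m : ℝ) + 1) * S / (exp 1 * θ)) ^ (m + 1) := by
    have hS0 : S ≠ 0 := hS.ne'
    have hθ0 : θ ≠ 0 := hθ.ne'
    have he0 : exp 1 ≠ 0 := (Real.exp_pos 1).ne'
    rw [div_pow, div_pow, mul_pow, mul_pow]
    field_simp
    ring
  -- the geometric factor is ≤ e^{-(m+1)} ≤ e^{1 - θ/S}
  have hq : ((m : ℝ) + 1) * S / (exp 1 * θ) ≤ (exp 1)⁻¹ := by
    have h1 : ((m : ℝ) + 1) * S ≤ θ := by rwa [le_div_iff₀ hS] at hNx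
    rw [div_le_iff₀ (by positivity)]
    calc ((m : ℝ) + 1) * S ≤ θ := h1
      _ = (exp 1)⁻¹ * (exp 1 * θ) := by field_simp
  have hq0 : 0 ≤ ((m : ℝ) + 1) * S / (exp 1 * θ) := by positivity
  have hgeom : (((m : ℝ) + 1) * S / (exp 1 * θ)) ^ (m + 1) ≤ exp (1 - θ / S) := by
    calc (((m : ℝ) + 1) * S / (exp 1 * θ)) ^ (m + 1) ≤ ((exp 1)⁻¹) ^ (m + 1) := pow_le_pow_left₀ hq0 hq _
      _ = exp (-((m : ℝ) + 1)) := by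
          rw [← Real.exp_neg, ← Real.exp_nat_mul]; congr 1; push_cast; ring
      _ ≤ exp (1 - θ / S) := Real.exp_le_exp.mpr (by linarith)
  have hsqrt : √((m : ℝ) + 1) ≤ √(θ / S) := Real.sqrt_le_sqrt hNx
  -- assemble
  have hmain : D ≤ C₁ * (exp 1 * √(θ / S) / S) * exp (1 - θ / S) := by
    have h1 : C₁ * (exp 1 * √((m : ℝ) + 1) / S) * (((m : ℝ) + 1) * S / (exp 1 * θ)) ^ (m + 1)
        ≤ C₁ * (exp 1 * √((m : ℝ) + 1) / S) * exp (1 - θ / S) :=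
      mul_le_mul_of_nonneg_left hgeom (by positivity)
    have h2 : C₁ * (exp 1 * √((m : ℝ) + 1) / S) * exp (1 - θ / S)
        ≤ C₁ * (exp 1 * √(θ / S) / S) * exp (1 - θ / S) := by
      have : exp 1 * √((m : ℝ) + 1) / S ≤ exp 1 * √(θ / S) / S := by
        rw [div_le_div_iff_of_pos_right hS]
        exact mul_le_mul_of_nonneg_left hsqrt (Real.exp_pos 1).le
      exact mul_le_mul_of_nonneg_right (mul_le_mul_of_nonneg_left this hC) (Real.exp_pos _).le
    calc D ≤ _ := hDm
      _ ≤ _ := hstep1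
      _ = _ := hrew
      _ ≤ _ := h1
      _ ≤ _ := h2
  -- convert to the `key_ineq` shape with x = θ/S
  have hkey := key_ineq (θ / S) hx1
  have hconv : C₁ * (exp 1 * √(θ / S) / S) * exp (1 - θ / S)
      = C₁ / θ * (exp 1 ^ 2 * (θ / S) * √(θ / S) * exp (-(θ / S))) := by
    have hS0 : S ≠ 0 := hS.ne'
    have hθ0 : θ ≠ 0 := hθ.ne'
    have hexp : exp (1 - θ / S) = exp 1 * exp (-(θ / S)) := by rw [← Real.exp_add]; ring_nf
    rw [hexp]
    field_simp
  have hfin : C₁ / θ * (exp 1 ^ 2 * (θ / S) * √(θ / S) * exp (-(θ / S))) ≤ C₁ / θ * (9 * exp (-(θ / S / 2))) :=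
    mul_le_mul_of_nonneg_left hkey (by positivity)
  have hlast : C₁ / θ * (9 * exp (-(θ / S / 2))) = 9 * C₁ / θ * exp (-(θ / (2 * S))) := by
    rw [div_div]; ring_nf
  calc D ≤ _ := hmain
    _ = _ := hconv
    _ ≤ _ := hfin
    _ = _ := hlast

/-- **S1 PROVED (was `stub_gevreyFlatness`).** An `S`-periodic smooth curve with Gevrey-1 bounds
`‖g⁽ⁿ⁾‖ ≤ C₁ n!/θⁿ` (`n ≥ 1`) and `0 < S ≤ θ` is super-exponentially flat: `‖g'‖ ≤ 9C₁θ⁻¹e^{−θ/(2S)}`. -/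
theorem gevreyFlatness_holds {g : ℝ → EuclideanSpace ℝ (Fin 3)} {S C₁ θ : ℝ} (hS : 0 < S) (hSθ : S ≤ θ)
    (hper : Function.Periodic g S) (hg : ∀ n : ℕ, ContDiff ℝ n g)
    (hb : ∀ n : ℕ, 1 ≤ n → ∀ s : ℝ, ‖iteratedDeriv n g s‖ ≤ C₁ * (n ! : ℝ) / θ ^ n) :
    ∀ s : ℝ, ‖deriv g s‖ ≤ 9 * C₁ / θ * Real.exp (-(θ / (2 * S))) := by
  have hθ : 0 < θ := lt_of_lt_of_le hS hSθ
  have hC : 0 ≤ C₁ := by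
    have h := (norm_nonneg _).trans (hb 1 le_rfl 0)
    rw [Nat.factorial_one, Nat.cast_one, mul_one, pow_one] at h
    exact (div_nonneg_iff.mp h).elim (fun h => h.1) (fun h => absurd h.2 (not_le.mpr hθ))
  -- periodicity and smoothness of all derivatives
  have hperk : ∀ k : ℕ, Function.Periodic (iteratedDeriv k g) S := by
    intro k x
    have h := congrFun (iteratedDeriv_comp_add_const (n := k) (f := g) (s := S)) x
    have hfun : (fun z => g (z + S)) = g := funext hper
    rw [hfun] at h
    exact h.symm
  have hgk : ∀ k : ℕ, ContDiff ℝ 2 (iteratedDeriv k g) := by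
    intro k
    rw [iteratedDeriv_eq_iterate]
    exact ContDiff.iterate_deriv' 2 k (hg (2 + k))
  have h2k : ∀ k : ℕ, ∀ s, iteratedDeriv 2 (iteratedDeriv k g) s = iteratedDeriv (k + 1 + 1) g s := by
    intro k s
    simp only [iteratedDeriv_eq_iterate]
    rw [← Function.iterate_add_apply, show 2 + k = k + 1 + 1 by ring]
  have h1k : ∀ k : ℕ, deriv (iteratedDeriv k g) = iteratedDeriv (k + 1) g := fun k =>
    (iteratedDeriv_succ (n := k) (f := g)).symm
  -- the iterated Poincaré bound: ‖g^{(k+1)}‖ ≤ S^{j+1} · C₁ (k+j+2)!/θ^{k+j+2}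
  have hQ : ∀ j k : ℕ, ∀ s, ‖iteratedDeriv (k + 1) g s‖ ≤
      S ^ (j + 1) * (C₁ * ((k + j + 2)! : ℝ) / θ ^ (k + j + 2)) := by
    intro j
    induction j with
    | zero =>
        intro k s
        have hP := periodic_deriv_norm_le hS (hperk k) (hgk k)
          (B := C₁ * ((k + 2)! : ℝ) / θ ^ (k + 2)) (fun σ => by rw [h2k k σ]; exact hb (k + 2) (by omega) σ) s
        rw [h1k k] at hP
        simpa [pow_one, mul_comm] using hP
    | succ j ih =>
        intro k s
        have hB : ∀ σ, ‖iteratedDeriv 2 (iteratedDeriv k g) σ‖ ≤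
            S ^ (j + 1) * (C₁ * ((k + 1 + j + 2)! : ℝ) / θ ^ (k + 1 + j + 2)) := fun σ => by
          rw [h2k k σ]; exact ih (k + 1) σ
        have hP := periodic_deriv_norm_le hS (hperk k) (hgk k) hB s
        rw [h1k k] at hP
        have e1 : k + 1 + j + 2 = k + (j + 1) + 2 := by ring
        rw [e1] at hP
        calc ‖iteratedDeriv (k + 1) g s‖ ≤ S ^ (j + 1) * (C₁ * ((k + (j + 1) + 2)! : ℝ) / θ ^ (k + (j + 1) + 2)) * S := hP
          _ = S ^ (j + 1 + 1) * (C₁ * ((k + (j + 1) + 2)! : ℝ) / θ ^ (k + (j + 1) + 2)) := by ring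
  intro s
  refine flat_optimise hC hS hSθ (fun m => ?_)
  cases m with
  | zero =>
      have h := hb 1 le_rfl s
      rw [iteratedDeriv_one] at h
      simpa using h
  | succ j =>
      have h := hQ j 0 s
      rw [zero_add, iteratedDeriv_one] at h
      calc ‖deriv g s‖ ≤ S ^ (j + 1) * (C₁ * ((0 + j + 2)! : ℝ) / θ ^ (0 + j + 2)) := h
        _ = C₁ * ((j + 1 + 1)! : ℝ) * S ^ (j + 1) / θ ^ (j + 1 + 1) := by
            simp only [zero_add, show j + 2 = j + 1 + 1 from rfl]; ring

end GevreyFlatness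

end Summit.NavierStokesRegularity.NavierStokesRegularity.Cruxes.TypeIQuantSubcubicExp.AnalyticWindow

end
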